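import Literature.Analysis.FluidPDE.TorusClassicalNSH4Smoothing

/-!
# The sup-in-time `H⁴` smoothing bound on `T³` (tools stub `stub_h4SupSmoothingTools`, block N-E, line
# `ergodic-budget-selection-closing`, crux `BaireTransfer.DenseLoudDesignerForces`, stmt-AnomalousDissipation-1143)

Summit-side specialisation to `T³ = UnitAddTorus (Fin 3)` of the Literature estimate
`Torus.IsClassicalNSSolutionOn.integral_norm_laplacian_laplacian_sq_le_of_le`
(`Literature/Analysis/FluidPDE/TorusClassicalNSH4Smoothing.lean`): for `ν > 0` and a classical solution of
NS_ν on `[a, a + τ] × T³` with zero-mean slices, sup bounds `‖∇u‖₂² ≤ E₁`, `‖Δu‖₂² ≤ Y₁`, `‖∇Δu‖₂² ≤ Z₁`,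
`‖Δf‖₂² ≤ G₂`, `‖∇Δf‖₂² ≤ G₃`, `‖u‖_∞ ≤ M`, `‖∂ᵢu‖_∞ ≤ Λ₁` on the interval give
`‖Δ²u(a + τ)‖₂² ≤ C(ν, E₁, Y₁, Z₁, G₂, G₃, M, Λ₁, τ)` — the `k = 4` step of the regularity ladder of
Robinson–Rodrigo–Sadowski 2016, Thm 7.1 ((7.3): once `‖u‖_{H³}` and `‖u‖_{W^{1,∞}}` are bounded the inequality
for `‖Δ²u‖₂²` is linear, and a time of controlled `‖Δ²u‖₂²` comes from the `L²_t H⁴` bound of the previous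
level by Chebyshev).  This is the sup-in-time `H⁴` control through which block N-E (strong solutions near the
invariant core) makes the invariant core bounded in `H⁴`.  The registered tools stub `stub_h4SupSmoothingTools`
is proved BY NAME with exactly the registered signature.

References: Robinson–Rodrigo–Sadowski, *The Three-Dimensional Navier–Stokes Equations* (CUP 2016) Thm 7.1 (7.3),
Thm 7.5; Constantin–Foias, *Navier–Stokes Equations* (1988) Thm 10.6.
-/

-- `Summit.<Summit>.<Problem>` is the tree's mandated summit-side namespace (CONVENTIONS §2); for this
-- single-conjunct summit the two coincide, so the duplicate is deliberate.
set_option linter.dupNamespace false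

noncomputable section

open scoped BigOperators Topology ENNReal InnerProductSpace
open Filter Set Function MeasureTheory

namespace Summit.AnomalousDissipation.AnomalousDissipation.Theorems.DenseLoudDesignerForces.Ergodic

open Literature.Analysis.FunctionSpaces Literature.Analysis.FunctionSpaces.Torus
open Literature.Analysis.FluidPDE Literature.Analysis.FluidPDE.Torus

/-- **Tools stub of block N-E (`stub_h4SupSmoothingTools`, crux stmt-AnomalousDissipation-1143, line
`ergodic-budget-selection-closing`) — the sup-in-time `H⁴` smoothing bound.**  For `ν > 0` and a classical
solution of NS_ν on `[a, a + τ] × T³` with zero-mean slices, sup bounds `‖∇u‖₂² ≤ E₁`, `‖Δu‖₂² ≤ Y₁`,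
`‖∇Δu‖₂² ≤ Z₁`, `‖Δf‖₂² ≤ G₂`, `‖∇Δf‖₂² ≤ G₃`, `‖u‖ ≤ M`, `‖∂ᵢu‖ ≤ Λ₁` on the interval give
`∫ ‖ΔΔu(a + τ)‖² ≤ C(ν, E₁, Y₁, Z₁, G₂, G₃, M, Λ₁, τ)`: the `H⁴` balance
`d/dt ½‖Δ²u‖₂² = −ν‖∇Δ²u‖₂² − ∫⟪(u·∇)u − f, Δ⁴u⟫` with the flux bound `≤ ν⁻¹(‖∇Δf‖₂² + ‖∇Δ((u·∇)u)‖₂²)`, the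
inertial bound `‖∇Δ((u·∇)u)‖₂² ≤ C((M² + ‖Δu‖₂²)‖Δ²u‖₂² + (Λ₁² + ‖Δu‖₂²)‖∇Δu‖₂²)` on `T³` (affine in
`‖Δ²u‖₂²`), a Chebyshev time of controlled `‖Δ²u‖₂²` from the `L²_t H⁴` bound, and Grönwall by fencing
(`Torus.IsClassicalNSSolutionOn.integral_norm_laplacian_laplacian_sq_le_of_le` at `d = Fin 3`).
RRS 2016 Thm 7.1 (7.3), `k = 4`. [cite: RobinsonRodrigoSadowskiCUP2016, Thm 7.1 and Thm 7.5] -/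
theorem stub_h4SupSmoothingTools {ν : ℝ} (hν : 0 < ν) (E₁ Y₁ Z₁ G₂ G₃ M Λ₁ τ : ℝ) (hτ : 0 < τ) :
    ∃ C : ℝ, ∀ {a : ℝ} {f u : ℝ → (UnitAddTorus (Fin 3)) → (EuclideanSpace ℝ (Fin 3))} {p : ℝ → (UnitAddTorus (Fin 3)) → ℝ},
      IsClassicalNSSolutionOn (Icc a (a + τ)) ν f u p → (∀ t ∈ Icc a (a + τ), HasZeroMean (u t)) →
      (∀ t ∈ Icc a (a + τ), gradNormSq (u t) ≤ E₁) → (∀ t ∈ Icc a (a + τ), ∫ x, ‖laplacian (u t) x‖ ^ 2 ≤ Y₁) →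
      (∀ t ∈ Icc a (a + τ), gradNormSq (laplacian (u t)) ≤ Z₁) →
      (∀ t ∈ Icc a (a + τ), ∫ x, ‖laplacian (f t) x‖ ^ 2 ≤ G₂) → (∀ t ∈ Icc a (a + τ), gradNormSq (laplacian (f t)) ≤ G₃) →
      (∀ t ∈ Icc a (a + τ), ∀ x, ‖u t x‖ ≤ M) → (∀ i, ∀ t ∈ Icc a (a + τ), ∀ x, ‖partialDeriv i (u t) x‖ ≤ Λ₁) →
      ∫ x, ‖laplacian (laplacian (u (a + τ))) x‖ ^ 2 ≤ C :=
  IsClassicalNSSolutionOn.integral_norm_laplacian_laplacian_sq_le_of_le (d := Fin 3)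
    (Fintype.card_fin 3) hν E₁ Y₁ Z₁ G₂ G₃ M Λ₁ hτ

end Summit.AnomalousDissipation.AnomalousDissipation.Theorems.DenseLoudDesignerForces.Ergodic

end
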